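import Summits.Ventures.PercRepro.ClassSum

/-!
# PercRepro — the marked MINOR of a class, and the minor-invariance of the class sums (typer-2, gen 4)

`LEAD-C011-concavity.md` §10.9–§10.11: «in a general graph the class sums depend only on the marked
minor (contract the sure edges, delete the closed ones, keep the free edges)». Here the minor is a
`MultiGraph` on the quotient `V / Conn v` by sure-connectivity, with the free edges `Face u v` as
edges (`minor`), and

* **`conn_embed_iff`** — connectivity of `embed u v ρ` in `G` is connectivity of `ρ` in the minor
  (`G.Conn (embed u v ρ) x y ↔ (G.minor u v).Conn ρ ⟦x⟧ ⟦y⟧`);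
* **`markedPartition_embed`** — the marked partition transports to the minor (marks ↦ classes);
* `embed_update_face` — opening / closing a free edge commutes with `embed`;
* **`mergeVecM_embed`** — for `g` free in the class, the merge vector of `G` along `g` at
  `embed u v σ` is the merge vector of the minor along `⟨g, _⟩` at `σ` (the TYPES are
  minor-invariant);
* `extendClosed`, `embed_extendClosed`, **`classSum_eq_minor`** — the class sum `S(u, v)` of a
  class with `g` closed is the corresponding antipodal sum of the merge kernel of the minor
  `G.minor u[g := true] v` along `⟨g, _⟩` with the marks' classes as marks: `S` is a function of
  the marked minor alone.
-/

namespace PercRepro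

open Finset

section FaceLemmas

variable {E : Type*}

/-- The sure configuration is below every configuration of the class. -/
theorem le_embed (u v : Config E) (ρ : Config (Face u v)) : v ≤ embed u v ρ := by
  intro e
  unfold embed
  split_ifs with h
  · rw [h.1]
    exact Bool.false_le _
  · exact le_rfl


variable [DecidableEq E]

/-- Opening or closing a free edge commutes with `embed`. -/
theorem embed_update_face (u v : Config E) (σ : Config (Face u v)) (e : E)
    (he : v e = false ∧ u e = true) (b : Bool) :
    embed u v (Function.update σ ⟨e, he⟩ b) = Function.update (embed u v σ) e b := by
  funext f
  by_cases hf : v f = false ∧ u f = true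
  · rw [embed_apply_of_mem u v _ hf]
    by_cases hfe : f = e
    · subst hfe
      rw [Function.update_self, Function.update_self]
    · rw [Function.update_of_ne hfe, Function.update_of_ne (fun h => hfe (congrArg Subtype.val h)),
        embed_apply_of_mem u v σ hf]
  · have hfe : f ≠ e := fun h => hf (by rw [h]; exact he)
    rw [embed_apply_of_not u v _ hf, Function.update_of_ne hfe, embed_apply_of_not u v σ hf]


/-- Extend a configuration of the face of `(u, v)` to the face of `(u[g := true], v)` by closing
`g` (for `g` closed in the class `(u, v)`). -/
def extendClosed (u v : Config E) (g : E) (ρ : Config (Face u v)) :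
    Config (Face (Function.update u g true) v) := fun e =>
  if h : e.1 = g then false else
    ρ ⟨e.1, ⟨e.2.1, by have := e.2.2; rwa [Function.update_of_ne h] at this⟩⟩

/-- The extension embeds to the same configuration of `G`. -/
theorem embed_extendClosed {u v : Config E} {g : E} (hu : u g = false) (hv : v g = false)
    (ρ : Config (Face u v)) :
    embed (Function.update u g true) v (extendClosed u v g ρ) = embed u v ρ := by
  funext f
  by_cases hfg : f = g
  · subst hfg
    rw [embed_apply_of_mem _ _ _ ⟨hv, by simp⟩, embed_apply_of_not u v ρ (by simp [hu])]
    simp [extendClosed, hv]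
  · by_cases hf : v f = false ∧ u f = true
    · have hf' : v f = false ∧ Function.update u g true f = true :=
        ⟨hf.1, by rw [Function.update_of_ne hfg]; exact hf.2⟩
      rw [embed_apply_of_mem _ _ _ hf', embed_apply_of_mem u v ρ hf]
      simp [extendClosed, hfg]
    · have hf' : ¬ (v f = false ∧ Function.update u g true f = true) := by
        rwa [Function.update_of_ne hfg]
      rw [embed_apply_of_not _ _ _ hf', embed_apply_of_not u v ρ hf]


end FaceLemmas

namespace MultiGraph

variable {V E : Type*} (G : MultiGraph V E)

/-- The sure cluster of `x` in the class `(·, v)`: the vertex of the minor carrying `x`. -/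
abbrev sureClass (v : Config E) (x : V) : Quotient (G.connSetoid v) :=
  Quotient.mk (G.connSetoid v) x

/-- Two vertices have the same sure cluster iff they are joined by sure edges. -/
theorem sureClass_eq_iff (v : Config E) (x y : V) :
    G.sureClass v x = G.sureClass v y ↔ G.Conn v x y :=
  Quotient.eq

/-- **The marked minor of the class `(join u, meet v)`**: the sure edges `v` are contracted
(vertices = the sure clusters), the closed edges (outside `u`) are deleted, the free edges
`Face u v` survive, joining the sure clusters of their endpoints. -/
def minor (u v : Config E) : MultiGraph (Quotient (G.connSetoid v)) (Face u v) where
  fst e := G.sureClass v (G.fst e.1)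
  snd e := G.sureClass v (G.snd e.1)

/-- **Connectivity in a class is connectivity in its minor**:
`x ↔ y` in `embed u v ρ` iff their sure clusters are joined in the minor by `ρ`. -/
theorem conn_embed_iff (u v : Config E) (ρ : Config (Face u v)) (x y : V) :
    G.Conn (embed u v ρ) x y ↔ (G.minor u v).Conn ρ (G.sureClass v x) (G.sureClass v y) := by
  constructor
  · intro h
    unfold Conn at h
    induction h with
    | refl => exact Conn.refl _ _ _
    | @tail z w _ hzw ih =>
      refine ih.trans ?_
      obtain ⟨e, he, hend⟩ := hzw
      by_cases hf : v e = false ∧ u e = true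
      · rw [embed_apply_of_mem u v ρ hf] at he
        refine Conn.of_openAdj ⟨⟨e, hf⟩, he, ?_⟩
        rcases hend with ⟨h1, h2⟩ | ⟨h1, h2⟩
        · exact Or.inl ⟨by rw [← h1]; rfl, by rw [← h2]; rfl⟩
        · exact Or.inr ⟨by rw [← h1]; rfl, by rw [← h2]; rfl⟩
      · rw [embed_apply_of_not u v ρ hf] at he
        have hv : G.Conn v (G.fst e) (G.snd e) := Conn.of_openAdj (G.openAdj_of_open e he)
        have hzw' : G.Conn v z w := by
          rcases hend with ⟨h1, h2⟩ | ⟨h1, h2⟩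
          · rw [← h1, ← h2]
            exact hv
          · rw [← h1, ← h2]
            exact hv.symm
        rw [(G.sureClass_eq_iff v z w).mpr hzw']
        exact Conn.refl _ _ _
  · intro h
    suffices key : ∀ q q' : Quotient (G.connSetoid v), (G.minor u v).Conn ρ q q' →
        ∀ x y : V, G.sureClass v x = q → G.sureClass v y = q' → G.Conn (embed u v ρ) x y from
      key _ _ h x y rfl rfl
    intro q q' h
    unfold Conn at h
    induction h with
    | refl =>
      intro x y hx hy
      have hxy : G.Conn v x y := (G.sureClass_eq_iff v x y).mp (hx.trans hy.symm)
      exact hxy.mono (le_embed u v ρ)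
    | @tail q₁ q₂ _ hadj ih =>
      intro x y hx hy
      obtain ⟨e, he, hend⟩ := hadj
      have he' : embed u v ρ e.1 = true := by
        rw [embed_apply_of_mem u v ρ e.2]
        exact he
      have hopen : G.Conn (embed u v ρ) (G.fst e.1) (G.snd e.1) :=
        Conn.of_openAdj (G.openAdj_of_open e.1 he')
      rcases hend with ⟨h1, h2⟩ | ⟨h1, h2⟩
      · have hx1 : G.Conn (embed u v ρ) x (G.fst e.1) := ih x (G.fst e.1) hx h1
        have hy2 : G.Conn (embed u v ρ) (G.snd e.1) y :=
          ((G.sureClass_eq_iff v _ _).mp (h2.trans hy.symm)).mono (le_embed u v ρ)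
        exact (hx1.trans hopen).trans hy2
      · have hx1 : G.Conn (embed u v ρ) x (G.snd e.1) := ih x (G.snd e.1) hx h2
        have hy2 : G.Conn (embed u v ρ) (G.fst e.1) y :=
          ((G.sureClass_eq_iff v _ _).mp (h1.trans hy.symm)).mono (le_embed u v ρ)
        exact (hx1.trans hopen.symm).trans hy2

/-- **The marked partition transports to the minor**: the marks become their sure clusters. -/
theorem markedPartition_embed (u v : Config E) (ρ : Config (Face u v)) {k : ℕ} (m : Fin k → V) :
    G.markedPartition (embed u v ρ) m =
      (G.minor u v).markedPartition ρ (fun i => G.sureClass v (m i)) := by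
  ext i j
  exact G.conn_embed_iff u v ρ (m i) (m j)

variable [DecidableEq E]

/-- **The merge vectors are minor-invariant**: for `g` free in the class `(u, v)`, the merge vector
of `G` along `g` at `embed u v σ` is the merge vector of the minor along `⟨g, _⟩` at `σ`, with the
marks replaced by their sure clusters. -/
theorem mergeVecM_embed (u v : Config E) (g : E) (hg : v g = false ∧ u g = true)
    (m : Fin 4 → V) (σ : Config (Face u v)) :
    G.mergeVecM g m (embed u v σ) =
      (G.minor u v).mergeVecM ⟨g, hg⟩ (fun i => G.sureClass v (m i)) σ := by
  funext s
  simp only [mergeVecM]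
  rw [← embed_update_face u v σ g hg true, ← embed_update_face u v σ g hg false,
    G.markedPartition_embed, G.markedPartition_embed]

variable [Fintype E]

/-- **The class sums are minor-invariant**: the class sum `S(u, v)` of `G` along `g` (with `g`
closed in the class) is minus the antipodal sum of the merge kernel of the minor
`G.minor u[g := true] v` along `⟨g, _⟩` — a function of the marked minor alone (the configurations
of the minor's cube are the extensions of those of `Face u v` by `g` closed). -/
theorem classSum_eq_minor {u v : Config E} {g : E} (hu : u g = false) (hv : v g = false)
    (m : Fin 4 → V) :
    G.classSum g m u v = -∑ ρ : Config (Face u v),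
      quadPlus ((G.minor (Function.update u g true) v).mergeVecM ⟨g, ⟨hv, by simp⟩⟩
          (fun i => G.sureClass v (m i)) (extendClosed u v g ρ))
        ((G.minor (Function.update u g true) v).mergeVecM ⟨g, ⟨hv, by simp⟩⟩
          (fun i => G.sureClass v (m i)) (extendClosed u v g ρᶜ)) := by
  unfold classSum
  congr 1
  refine Finset.sum_congr rfl fun ρ _ => ?_
  rw [← embed_extendClosed hu hv ρ, ← embed_extendClosed hu hv ρᶜ,
    G.mergeVecM_embed _ v g ⟨hv, by simp⟩ m, G.mergeVecM_embed _ v g ⟨hv, by simp⟩ m]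

end MultiGraph

end PercRepro
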